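import Summits.HodgeConjecture.HodgeCM.Proofs.LandherrLocalGlobal_1

/-! PORT of `HodgeCM/Proofs/LandherrLocalGlobal.lean` (HodgeCMPerL run 82) — part 2: continuation of `Summits.HodgeConjecture.HodgeCM.Proofs.LandherrLocalGlobal_1` (split at a top-level declaration boundary by port_pkg.py; scope re-opened below; declarations unchanged). -/

-- port_pkg: scope re-opened for this part (file-level context, then the namespace/section stack open at the cut)
set_option autoImplicit false
noncomputable section
open scoped Matrix
open NumberField NumberField.InfinitePlace IsDedekindDomain
open Literature.NumberTheory.QuadraticForms
open Literature.AlgebraicGeometry.ShimuraVarieties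
namespace HodgeCM
namespace HermSpace3
variable {L : CMField} {ι₁ : L →+* ℂ}
/-- **The quotient of two admissible discriminants with the same finite local invariants is a norm from `L`.**
All its local Hilbert symbols `(d/d', a)_𝔭` are `1` — at the finite places by hypothesis and multiplicativity, at the
real places because `d` and `d'` have the same sign everywhere (§1) — so by Hasse's norm theorem for the quadratic
extension `L/L₀` (O'Meara 65:23, the cone's `hilbertSymbol_eq_one_of_forall_completions_holds`) `(d/d', a)_{L₀} = 1`,
i.e. `d/d' = x² - a y² = N(x + yα)`. -/
theorem AdmissibleDisc.exists_eq_mul_relNorm {d d' : maximalRealSubfield L} (hd : AdmissibleDisc L ι₁ (d : L))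
    (hd' : AdmissibleDisc L ι₁ (d' : L)) (h : negPlaces d = negPlaces d') :
    ∃ z : L, z ≠ 0 ∧ d = d' * relNorm z := by
  have hd0 : d ≠ 0 := ne_zero_of_coe_ne_zero hd.ne_zero
  have hd0' : d' ≠ 0 := ne_zero_of_coe_ne_zero hd'.ne_zero
  set θ : maximalRealSubfield L := d / d' with hθ
  have hθ0 : θ ≠ 0 := div_ne_zero hd0 hd0'
  have hdθ : d = θ * d' := by rw [hθ, div_mul_cancel₀ d hd0']
  -- finite places
  have hfin : ∀ v : HeightOneSpectrum (𝓞 (maximalRealSubfield L)), localSymbol θ v = 1 := by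
    intro v
    have h1 : localSymbol d v = localSymbol d' v :=
      localSymbol_eq_of_neg_iff (by rw [← mem_negPlaces_iff, ← mem_negPlaces_iff, h])
    rw [hdθ, localSymbol_mul hθ0 hd0'] at h1
    rcases localSymbol_eq_one_or θ v with h2 | h2
    · exact h2
    · exfalso
      rw [h2] at h1
      rcases localSymbol_eq_one_or d' v with h3 | h3 <;> rw [h3] at h1 <;> norm_num at h1
  -- infinite places
  have hinf : ∀ w : InfinitePlace (maximalRealSubfield L),
      hilbertSymbol w.Completion (algebraMap (maximalRealSubfield L) _ θ)
        (algebraMap (maximalRealSubfield L) _ (cmGenerator L)) = 1 := by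
    intro w
    have hw := isReal_infinitePlace w
    rw [hilbertSymbol_completion_eq_one_iff_of_isReal hw]
    left
    rw [hθ, map_div₀]
    by_cases hwb : w = basePlace ι₁
    · exact div_pos_of_neg_of_neg ((hd.embedding_neg_iff w hw).2 hwb) ((hd'.embedding_neg_iff w hw).2 hwb)
    · exact div_pos ((hd.embedding_pos_iff w hw).2 hwb) ((hd'.embedding_pos_iff w hw).2 hwb)
  -- Hasse's norm theorem
  have hglob : hilbertSymbol (maximalRealSubfield L) θ (cmGenerator L) = 1 := by
    rw [hilbertSymbol_comm]
    refine Literature.NumberTheory.Automorphic.hilbertSymbol_eq_one_of_forall_completions_holds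
      (maximalRealSubfield L) (cmGenerator L) θ (cmGenerator_not_isSquare L) hθ0 (fun v => ?_) (fun w => ?_)
    · rw [hilbertSymbol_comm]; exact hfin v
    · rw [hilbertSymbol_comm]; exact hinf w
  have hnorm : ∃ x y : maximalRealSubfield L, x ^ 2 - cmGenerator L * y ^ 2 = θ := by
    have h1 := (hilbertSymbol_eq_one_iff_mem_quadraticNormSubgroup (cmGenerator_ne_zero L) (Units.mk0 θ hθ0)).1
      (by rw [Units.val_mk0]; exact hglob)
    exact mem_quadraticNormSubgroup_iff.1 h1
  obtain ⟨x, y, hxy⟩ := hnorm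
  obtain ⟨z, hz⟩ := sq_sub_mul_sq_eq_relNorm x y
  have hz0 : z ≠ 0 := by
    rintro rfl
    apply hθ0
    rw [← hxy, hz]
    exact Subtype.ext (by simp)
  exact ⟨z, hz0, by rw [hdθ, mul_comm, ← hz, hxy]⟩

/-- **Landherr's theorem, local form.**  Two hermitian 3-spaces of PerL's signatures over the CM field `L` are
isometric iff they have the same local invariants `ε_v(det h) = ε_v(det h')` at every finite place `v` of `L₀`, i.e.
iff `T(V) = T(V')` (Landherr 1936; Shimura, Doc. Math. 13 (2008) Thm 2.2; Scharlau Ch. 10 Ex. 1.6 (iii)).  The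
signatures being fixed by the type, no archimedean condition appears. -/
theorem isometric_iff_negPlaces_eq (V V' : HermSpace3 L ι₁) :
    (∃ g : GL (Fin 3) L, ((g : Matrix (Fin 3) (Fin 3) L).transpose.map (conjRingHomK L)) * V.Hm *
        (g : Matrix (Fin 3) (Fin 3) L) = V'.Hm) ↔
      negPlaces V.discr = negPlaces V'.discr := by
  rw [isometric_iff_det]
  constructor
  · rintro ⟨z, hz, h⟩
    have h' : V.discr = V'.discr * relNorm z := Subtype.ext (by simpa using h)
    rw [h', negPlaces_mul_relNorm V'.discr_ne_zero hz]
  · intro h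
    obtain ⟨z, hz, h'⟩ := V.admissibleDisc_discr.exists_eq_mul_relNorm V'.admissibleDisc_discr h
    exact ⟨z, hz, by simpa using congrArg (fun t : maximalRealSubfield L => (t : L)) h'⟩

/-- One direction on its own: spaces with the same local invariants are isometric. -/
theorem isometric_of_negPlaces_eq (V V' : HermSpace3 L ι₁) (h : negPlaces V.discr = negPlaces V'.discr) :
    ∃ g : GL (Fin 3) L, ((g : Matrix (Fin 3) (Fin 3) L).transpose.map (conjRingHomK L)) * V.Hm *
        (g : Matrix (Fin 3) (Fin 3) L) = V'.Hm :=
  (isometric_iff_negPlaces_eq V V').2 h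

/-- The other direction: the local invariants are isometry invariants. -/
theorem negPlaces_eq_of_isometric (V V' : HermSpace3 L ι₁) (g : GL (Fin 3) L)
    (hg : ((g : Matrix (Fin 3) (Fin 3) L).transpose.map (conjRingHomK L)) * V.Hm *
        (g : Matrix (Fin 3) (Fin 3) L) = V'.Hm) :
    negPlaces V.discr = negPlaces V'.discr :=
  (isometric_iff_negPlaces_eq V V').1 ⟨g, hg⟩

/-! ## §5. Realisation: every odd finite set of non-split places occurs (O'Meara 71:19) -/

/-- `a` is not a square in the completion of `L₀` at any real place (it is negative there). -/
theorem not_isSquare_cmGenerator_completion (w : InfinitePlace (maximalRealSubfield L)) :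
    ¬ IsSquare (algebraMap (maximalRealSubfield L) w.Completion (cmGenerator L)) :=
  Literature.NumberTheory.Automorphic.not_isSquare_completion_of_embedding_neg (maximalRealSubfield L)
    (isReal_infinitePlace w) (cmGenerator_neg L w _)

/-- **An element of `L₀` with prescribed local invariants is an admissible discriminant** when its archimedean symbols
are `-1` exactly at the base place. -/
theorem admissibleDisc_of_symbols {θ : maximalRealSubfield L} (hθ0 : θ ≠ 0)
    (hinf : ∀ w : InfinitePlace (maximalRealSubfield L),
      hilbertSymbol w.Completion (algebraMap (maximalRealSubfield L) _ θ)
        (algebraMap (maximalRealSubfield L) _ (cmGenerator L)) = -1 ↔ w = basePlace ι₁) :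
    AdmissibleDisc L ι₁ (θ : L) := by
  have key : ∀ W : InfinitePlace L, (W.embedding (θ : L)).re < 0 ↔ W = InfinitePlace.mk ι₁ := by
    intro W
    have hw := isReal_infinitePlace (IsCMField.equivInfinitePlace L W)
    rw [← embedding_of_isReal_eq_re W hw,
      ← hilbertSymbol_completion_eq_neg_one_iff_of_embedding_neg hw hθ0 (cmGenerator_neg L _ hw), hinf]
    exact (IsCMField.equivInfinitePlace L).injective.eq_iff
  have hne : ∀ W : InfinitePlace L, (W.embedding (θ : L)).re ≠ 0 := by
    intro W
    have hw := isReal_infinitePlace (IsCMField.equivInfinitePlace L W)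
    rw [← embedding_of_isReal_eq_re W hw]
    exact (_root_.map_ne_zero _).2 hθ0
  refine ⟨Lemma33bLandherrProof.conj_coe_maximalRealSubfield L θ, ?_, fun τ hτ => ?_⟩
  · rw [← LandherrRankN.re_embedding_mk ι₁]
    exact (key _).2 rfl
  · rw [← LandherrRankN.re_embedding_mk τ]
    have h1 : ¬ ((InfinitePlace.mk τ).embedding (θ : L)).re < 0 := fun h => hτ ((key _).1 h)
    exact lt_of_le_of_ne (not_lt.1 h1) (hne _).symm

/-- **Realisation of the local invariants.**  For every finite set `S` of finite places of `L₀` of ODD cardinality at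
each of which `a` is a local non-square (`v` non-split in `L = L₀(√a)`), there is a hermitian 3-space `(V₃,h)` of
PerL's signatures with `T(V) = S`: O'Meara 71:19 gives `θ ∈ L₀` with `(θ, a)_𝔭 = -1` exactly on `S ∪ {base place}`
(an even set), such a `θ` is an admissible discriminant, and `⟨1, 1, θ⟩` realises it (`HermSpace3.exists_det_eq`). -/
theorem exists_negPlaces_eq (S : Finset (HeightOneSpectrum (𝓞 (maximalRealSubfield L)))) (hS : Odd S.card)
    (ha : ∀ v ∈ S, ¬ IsSquare (algebraMap (maximalRealSubfield L) (v.adicCompletion (maximalRealSubfield L))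
      (cmGenerator L))) :
    ∃ V : HermSpace3 L ι₁, negPlaces V.discr = ↑S := by
  obtain ⟨θ, hθ0, hfin, hinf⟩ :=
    exists_hilbertSymbol_eq_neg_one_iff_of_hilbertReciprocity (maximalRealSubfield L)
      (hilbertReciprocity_holds (maximalRealSubfield L)) (cmGenerator L) S {basePlace ι₁}
      (fun w _ => isReal_infinitePlace w) (by rw [Finset.card_singleton]; exact hS.add_one)
      ha (fun w _ => not_isSquare_cmGenerator_completion w)
  have hadm : AdmissibleDisc L ι₁ (θ : L) :=
    admissibleDisc_of_symbols hθ0 (fun w => by rw [hinf w, Finset.mem_singleton])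
  obtain ⟨V, hV⟩ := exists_det_eq hadm
  refine ⟨V, ?_⟩
  have hdV : V.discr = θ := Subtype.ext hV
  ext v
  rw [hdV, mem_negPlaces_iff, Finset.mem_coe]
  exact hfin v

/-! ## §6. The classification by local invariants, collected; independence of the choice of `a` -/

/-- **Landherr's local–global classification of PerL's hermitian 3-spaces.**  Over a CM field `L = L₀(√a)` with a
distinguished complex embedding `ι₁`, for the hermitian 3-spaces `(V₃,h)` of signature `(2,1)` at the place of `ι₁`
and `(3,0)` at the other real places of `L₀`, with `T(V)` the set of finite places `v` of `L₀` where `(det h, a)_v = -1`: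
(1) `T(V)` is a finite set of ODD cardinality consisting of places non-split in `L`; (2) every finite set of odd
cardinality of non-split finite places is `T(V)` for some `V`; (3) `V ≅ V'` iff `T(V) = T(V')`.  So `V ↦ T(V)` is a
bijection from isometry classes onto the odd finite sets of non-split finite places of `L₀` — and none of these
classes is "locally trivial everywhere" (`T(V) ≠ ∅`). -/
theorem localGlobal_classification (L : CMField) (ι₁ : L →+* ℂ) :
    (∀ V : HermSpace3 L ι₁, (negPlaces V.discr).Finite ∧ Odd (negPlaces V.discr).ncard ∧
      ∀ v ∈ negPlaces V.discr, ¬ IsSquare (algebraMap (maximalRealSubfield L)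
        (v.adicCompletion (maximalRealSubfield L)) (cmGenerator L))) ∧
    (∀ S : Finset (HeightOneSpectrum (𝓞 (maximalRealSubfield L))), Odd S.card →
      (∀ v ∈ S, ¬ IsSquare (algebraMap (maximalRealSubfield L) (v.adicCompletion (maximalRealSubfield L))
        (cmGenerator L))) → ∃ V : HermSpace3 L ι₁, negPlaces V.discr = ↑S) ∧
    (∀ V V' : HermSpace3 L ι₁,
      (∃ g : GL (Fin 3) L, ((g : Matrix (Fin 3) (Fin 3) L).transpose.map (conjRingHomK L)) * V.Hm *
          (g : Matrix (Fin 3) (Fin 3) L) = V'.Hm) ↔ negPlaces V.discr = negPlaces V'.discr) :=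
  ⟨fun V => ⟨V.negPlaces_discr_finite, V.odd_ncard_negPlaces, fun _ hv => not_isSquare_of_mem_negPlaces hv⟩,
    fun S hS ha => exists_negPlaces_eq S hS ha, isometric_iff_negPlaces_eq⟩

/-- **Independence of the choice of `a`.**  For ANY `a' ∈ L₀` with `L = L₀(√a')` (`a'` a non-square in `L₀` that is a
square in `L`) the symbols `(d, a')_v` and `(d, a)_v` agree: `a' = a·q²` with `q = β/α ∈ L₀` (`β² = a'`, `α² = a`,
both anti-invariant under `σ`), and `(d, a·q²)_v = (d, a)_v` (the cone's `hilbertSymbol_mul_sq_right`, O'Meara §63B).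
So `ε_v` and `T(V)` are invariants of `(V₃,h)` and `L/L₀` alone. -/
theorem localSymbol_eq_of_generator {a' : maximalRealSubfield L} (ha' : ¬ IsSquare a') (hL : IsSquare (a' : L))
    (d : maximalRealSubfield L) (v : HeightOneSpectrum (𝓞 (maximalRealSubfield L))) :
    hilbertSymbol (v.adicCompletion (maximalRealSubfield L)) (algebraMap (maximalRealSubfield L) _ d)
      (algebraMap (maximalRealSubfield L) _ a') = localSymbol d v := by
  obtain ⟨β, hβ⟩ := hL
  have hβ2 : β ^ 2 = (a' : L) := by rw [hβ, sq]
  have hβc : conjRingHomK L β = -β := by rw [conjRingHomK_apply, IsCMField.complexConj_sqrt_eq_neg L ha' hβ2]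
  obtain ⟨α, hα0, hα2, hαc⟩ := cmGenerator_exists_sqrt L
  have hαc' : conjRingHomK L α = -α := by rw [conjRingHomK_apply, hαc]
  have hq : conjRingHomK L (β / α) = β / α := by rw [map_div₀, hβc, hαc', neg_div_neg_eq]
  set q : maximalRealSubfield L := ⟨β / α, Lemma33bLandherrProof.mem_maximalRealSubfield L hq⟩ with hqdef
  have hβ0 : β ≠ 0 := by
    rintro rfl
    apply ha'
    have : (a' : L) = 0 := by rw [← hβ2]; ring
    rw [show a' = 0 from Subtype.ext this]
    exact ⟨0, (mul_zero _).symm⟩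
  have hq0 : q ≠ 0 := by
    intro h
    have : β / α = 0 := congrArg (fun t : maximalRealSubfield L => (t : L)) h
    exact (div_ne_zero hβ0 hα0) this
  have haq : a' = cmGenerator L * q ^ 2 := by
    apply Subtype.ext
    change (a' : L) = (cmGenerator L : L) * (β / α) ^ 2
    rw [← hβ2, ← hα2]
    field_simp
  rw [haq, map_mul, map_pow, localSymbol]
  exact hilbertSymbol_mul_sq_right _ _ ((_root_.map_ne_zero _).2 hq0)

end HermSpace3

end HodgeCM

end
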